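import Summits.ResolutionOfSingularities.ResolutionOfSingularities.Theorems.EquisingularLiftEquisingularLiftBlowupModelFourOfCP2008
import Literature.AlgebraicGeometry.Cutkosky2009.Statements
import Literature.AlgebraicGeometry.Resolution.PatchingMorphismStep
import Literature.AlgebraicGeometry.Motives.CyclesDimensionFunctionField
import Literature.AlgebraicGeometry.Motives.CurveRiemannRoch
import HarnessLib

/-!
# Crux `EquisingularLift` (stmt-ResolutionOfSingularities-15660), line `Sketch` (skeleton v10c `f3e6993bf39ec5c9`):
# the `n = 4` leaf in characteristic `p > 5` from a THIRD printed source — Cutkosky 2009, Thm. 1.1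

[OURS · leafhand-res-equisingularlift-6 g2, 2026-08-31; cell `pub/decomp-res`] AI-produced, weaker than expert review; NOT a
statement of any manuscript; nothing here proves resolution of singularities in positive characteristic.  DEF-FREE helper
(no `def`), `--supports stmt-…-15660`; standard axioms; ONE named-fact binder (`Cutkosky2009.Thm1_1`, UNDISCHARGED — the result is CONDITIONAL).

The line's `n = 4` leaf `stub_blowupModel_four` (regular projective blow-up models of integral threefold hypersurfaces
`H ⊆ ℙ⁴_k`, `k = k̄` of characteristic `p`) is in the tree CONDITIONALLY on either of two printed theorems
(`stub_blowupModel_four_of_CP2008` ⟸ Cossart–Piltant 2008 Thm. 2.1; `stub_blowupModel_four_of_CP2019General` ⟸ CP 2019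
Thm. 1.1 (i)(ii)).  This file records the third, shorter source for the characteristics it covers:

  S. D. Cutkosky, *Resolution of singularities for 3-folds in positive characteristic*, Amer. J. Math. **131** (2009)
  59–127, Thm. 1.1: "Suppose that `V` is a projective variety of dimension 3 over an algebraically closed field `k` of
  characteristic ≠ 2, 3 or 5. Then there exists a nonsingular projective variety `W` and a birational morphism
  `φ : W → V`, which is an isomorphism above the nonsingular locus of `V`."  (tree: NAMED FACT `Cutkosky2009.Thm1_1`,
  `Literature/AlgebraicGeometry/Cutkosky2009/Statements.lean`, rendered for projective MODELS `M : ProjModel k K` of a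
  three-dimensional algebraic function field `K/k`).

* `isFunctionField₃_of_hypersurface` — for such an `H ⊆ ℙ⁴_k` with locally principal ideal and `ι` not an isomorphism,
  `K(H)/k` is finitely generated (`Motives.CurvePlaces.fg_top_functionField`) of transcendence degree `3`
  (`dim H = 3`: `topologicalKrullDim_of_hypersurface`; `dim = trdeg`: `Motives.height_top_eq_trdeg`, Görtz–Wedhorn I
  Thm. 5.22 (3)); the `k`-structure on `K(H) = 𝒪_{H,ξ}` is the tree's instance `Motives.RatFn.algebraStalk` for `H.Over (Spec k)`;
* ★ `stub_blowupModel_four_of_cutkosky2009` — **the `n = 4` leaf for `p > 5`, CONDITIONAL on `Cutkosky2009.Thm1_1.{0}` alone**: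
  Cutkosky's resolution is an isomorphism over `Reg H`, so the Raynaud–Gruson / principalization engine
  `admitsDesingularization_of_isResolution_dim_three` (CP 2019 Prop. 4.4 DISCHARGED, `CP2008Prop44.CossartPiltant2019Principalization_holds`)
  yields one `Sing H`-supported blow-up with regular source, i.e. a regular blow-up model (`blowupModel_of_admitsDesingularization`).
  After the fact binder and the extra hypothesis `5 < p` the type is the registered `stub_blowupModel_four` signature verbatim.

Honest label: no registered stub is closed (`stub_CP2019General` untouched; `p ∈ {2, 3, 5}` still needs CP 2008/2019); the
`n = 4` leaf now has THREE alternative single-fact sources, one of which (Cutkosky 2009) the tree is porting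
(`Cutkosky2009/*`, `Resolution/Cutkosky*`, `Resolution/ThreefoldResolution*`).

References: [Cutkosky2009, Thm. 1.1 (p. 1–2), proof §17]; [CossartPiltant2019, Prop. 4.4]; [GortzWedhorn2020, Thm. 5.22 (3)];
[StacksProject, Tags 081T, 080E, 080A, 080B].
-/

set_option linter.dupNamespace false -- mandated namespace `Summit.<Summit>.<Problem>` of this single-conjunct summit

noncomputable section

open CategoryTheory CategoryTheory.Limits AlgebraicGeometry TopologicalSpace Topology IsLocalRing
open Literature.AlgebraicGeometry.Resolution Literature.AlgebraicGeometry.Motives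
open Literature.AlgebraicGeometry.Cutkosky2009

universe u

namespace Summit.ResolutionOfSingularities.ResolutionOfSingularities.Cruxes.EquisingularLift.StrataSplit

/-! ## The function field of a threefold hypersurface is a three-dimensional algebraic function field -/

/-- **`K(H)/k` is an algebraic function field of dimension three** (`Cutkosky2009.IsFunctionField₃`: finitely generated of
transcendence degree `3`) for an integral closed `H ⊆ ℙ⁴_k` with locally principal ideal which is not all of `ℙ⁴_k`:
`K(H)` is generated by an affine coordinate ring (`Motives.CurvePlaces.fg_top_functionField`), and
`trdeg_k K(H) = dim H = 3` (`Motives.height_top_eq_trdeg`, `Motives.Scheme.height_genericPoint`, `topologicalKrullDim_of_hypersurface`).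
[cite: GortzWedhorn2020, Thm. 5.22 (3)] -/
theorem isFunctionField₃_of_hypersurface {k : Type u} [Field k] {H : Scheme.{u}} [IsIntegral H]
    (ι : H ⟶ (projectiveSpace 4 k).left) [IsClosedImmersion ι]
    (hloc : ∀ y : (projectiveSpace 4 k).left, ∃ U : (projectiveSpace 4 k).left.affineOpens,
      y ∈ (U : (projectiveSpace 4 k).left.Opens) ∧ (ι.ker.ideal U).IsPrincipal)
    (hiso : ¬ IsIso ι) :
    letI : H.Over (Spec (.of k)) := ⟨ι ≫ (projectiveSpace 4 k).hom⟩
    IsFunctionField₃ k H.functionField := by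
  letI : H.Over (Spec (.of k)) := ⟨ι ≫ (projectiveSpace 4 k).hom⟩
  let f : H ⟶ Spec (.of k) := ι ≫ (projectiveSpace 4 k).hom
  haveI : IsProper (projectiveSpace 4 k).hom := isProper_projectiveSpace 4 k
  haveI : LocallyOfFiniteType f := inferInstance
  refine ⟨?_, ?_⟩
  · -- finitely generated: the generators of an affine chart
    haveI : IsIntegral (Over.mk f).left := ‹IsIntegral H›
    haveI : LocallyOfFiniteType (Over.mk f).hom := ‹LocallyOfFiniteType f›
    exact CurvePlaces.fg_top_functionField (K := k) (Over.mk f)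
  · -- `trdeg_k K(H) = dim H = 3`
    have hdim : topologicalKrullDim H = ((3 : ℕ) : WithBot ℕ∞) :=
      topologicalKrullDim_of_hypersurface (n := 3) ι hloc hiso
    have hlt : Algebra.trdeg k H.functionField < Cardinal.aleph0 := trdeg_functionField_lt_aleph0 f
    have h := height_top_eq_trdeg f
    have key : topologicalKrullDim H =
        ((Cardinal.toNat (Algebra.trdeg k H.functionField) : ℕ∞) : WithBot ℕ∞) := by
      rw [← Literature.AlgebraicGeometry.Motives.Scheme.height_genericPoint]; exact h
    rw [hdim] at key
    have k2 : ((3 : ℕ) : ℕ∞) = (Cardinal.toNat (Algebra.trdeg k H.functionField) : ℕ∞) := by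
      rw [← WithBot.coe_inj]
      simpa only [WithBot.coe_natCast] using key
    have h3' : Cardinal.toNat (Algebra.trdeg k H.functionField) = 3 := by exact_mod_cast k2.symm
    have hc := Cardinal.cast_toNat_of_lt_aleph0 hlt
    rw [h3'] at hc
    exact_mod_cast hc.symm

/-! ## The `n = 4` leaf for `p > 5`, conditional on Cutkosky 2009 Thm. 1.1 -/

/-- ★ **The `n = 4` leaf `stub_blowupModel_four` in characteristic `p > 5`, CONDITIONAL on Cutkosky 2009 Thm. 1.1 alone**
(`Cutkosky2009.Thm1_1.{0}`; after this binder and the hypothesis `5 < p` the type is the registered signature verbatim).  For an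
integral closed `H ⊆ ℙ⁴_k` with locally principal ideal, `k = k̄` of characteristic `p > 5` (so `≠ 2, 3, 5`): if `ι` is an
isomorphism, `H ≅ ℙ⁴_k` is regular and `𝔞 = ⊤`; otherwise `H` is a projective model of the three-dimensional function field
`K(H)/k` (a term of the tree's `Resolution.ProjModel`, built inline as in `Theorems.stub_pair_equivariantFibration`;
`isFunctionField₃_of_hypersurface`), Cutkosky's Thm. 1.1 gives a resolution which is an
isomorphism over `Reg H`, the engine `admitsDesingularization_of_isResolution_dim_three` (Raynaud–Gruson + CP 2019 Prop. 4.4,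
the latter DISCHARGED: `CP2008Prop44.CossartPiltant2019Principalization_holds`) gives one `Sing H`-supported blow-up with regular
source, which is a regular blow-up model (`blowupModel_of_admitsDesingularization`).
[cite: Cutkosky2009, Thm. 1.1 (p. 1–2)] [cite: CossartPiltant2019, Prop. 4.4] [cite: StacksProject, Tag 081T; Tag 080B] -/
theorem stub_blowupModel_four_of_cutkosky2009 (hC : Literature.AlgebraicGeometry.Cutkosky2009.Thm1_1.{0}) : ∀ p : ℕ, p.Prime → 5 < p → ∀ (k : Type) [Field k] [CharP k p] [IsAlgClosed k] (n : ℕ) (H : AlgebraicGeometry.Scheme.{0}) (ι : H ⟶ (Literature.AlgebraicGeometry.Motives.projectiveSpace n k).left), AlgebraicGeometry.IsClosedImmersion ι → AlgebraicGeometry.IsIntegral H → (∀ y : (Literature.AlgebraicGeometry.Motives.projectiveSpace n k).left, ∃ U : (Literature.AlgebraicGeometry.Motives.projectiveSpace n k).left.affineOpens, y ∈ (U : (Literature.AlgebraicGeometry.Motives.projectiveSpace n k).left.Opens) ∧ (ι.ker.ideal U).IsPrincipal) → n = 4 → ∃ 𝔞 : H.IdealSheafData, 𝔞 ≠ ⊥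 ∧ ∀ (Z : AlgebraicGeometry.Scheme.{0}) (π : Z ⟶ H), Literature.AlgebraicGeometry.Resolution.IsBlowup π 𝔞 → Literature.AlgebraicGeometry.Resolution.Scheme.IsRegular Z := by
  intro p hp h5 k _ _ _ n H ι hι hH hloc hn
  subst hn
  by_cases hiso : IsIso ι
  · -- `H = ℙ⁴_k` is regular
    exact exists_blowupModel_of_isRegular
      (Scheme.IsRegular.of_iso (inv ι) (isRegular_projectiveSpace 4 k))
  · -- `H` is a projective model of the `3`-dimensional `K(H)/k`; Cutkosky 2009 Thm. 1.1
    letI : H.Over (Spec (.of k)) := ⟨ι ≫ (projectiveSpace 4 k).hom⟩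
    have hdim : topologicalKrullDim H = 3 := by
      rw [topologicalKrullDim_of_hypersurface (n := 3) ι hloc hiso]; rfl
    have hch : CharNot235 k := by
      refine ⟨?_, ?_, ?_⟩ <;> rw [ringChar.eq k p] <;> omega
    have hK : IsFunctionField₃ k H.functionField := isFunctionField₃_of_hypersurface ι hloc hiso
    haveI : IsProper (projectiveSpace 4 k).hom := isProper_projectiveSpace 4 k
    -- `H` as a projective model of `K(H)/k` (the tree's `ProjModel`; same term as in
    -- `Theorems.stub_pair_equivariantFibration`): generic point as the `K(H)`-point
    have hgenπ : H.fromSpecStalk (genericPoint H) ≫ (ι ≫ (projectiveSpace 4 k).hom) =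
        Spec.map (CommRingCat.ofHom (algebraMap k H.functionField)) := by
      have e : CommRingCat.ofHom (algebraMap k H.functionField) =
          (Scheme.ΓSpecIso (.of k)).inv ≫ (ι ≫ (projectiveSpace 4 k).hom).appTop ≫
            H.presheaf.germ ⊤ (genericPoint H) trivial :=
        rfl
      rw [e, Spec.map_comp, Spec.map_comp, Category.assoc, ← Scheme.fromSpecStalk_toSpecΓ_assoc,
        ← Scheme.toSpecΓ_naturality_assoc, toSpecΓ_SpecMap_ΓSpecIso_inv, Category.comp_id]
    let M : ProjModel k H.functionField :=
      { X := H
        π := ι ≫ (projectiveSpace 4 k).hom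
        gen := H.fromSpecStalk (genericPoint H)
        gen_π := hgenπ
        isIntegral := inferInstance
        isProjectiveOver := ⟨4, Over.homMk ι rfl, ‹IsClosedImmersion ι›⟩
        genericPt_eq := Scheme.fromSpecStalk_closedPoint
        isIso_stalkClosedPointTo := by
          rw [Scheme.stalkClosedPointTo_fromSpecStalk]; infer_instance }
    obtain ⟨X'', π, hπ, U, hU, hisoU⟩ := hC k H.functionField hch hK M
    haveI := hisoU
    exact blowupModel_of_admitsDesingularization
      (admitsDesingularization_of_isResolution_dim_three
        Summit.ResolutionOfSingularities.ResolutionOfSingularities.Theorems.CP2008Prop44.CossartPiltant2019Principalization_holds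
        (isExcellentRing_of_field k) H (ι ≫ (projectiveSpace 4 k).hom) hdim π hπ U hU)

end Summit.ResolutionOfSingularities.ResolutionOfSingularities.Cruxes.EquisingularLift.StrataSplit

end
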